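import Summits.CriticalPhenomena.PercolationContinuityZ3.Theorems.SahiBoxTP2HilbertReindex
import Mathlib.Combinatorics.SetFamily.FourFunctions

/-!
# Two-valued spins: laws on `{0,1}^ℕ` with FKG-lattice finite-dimensional marginals are Sahi-positive (given `C_n`)

Support file of the Sahi cell (`prim-sahi`, typer seat, generation 12; `--supports stmt-CriticalPhenomena-4575`).

The infinite-volume objects of statistical mechanics with two-valued spins (infinite-volume Ising states, random-cluster
limits, site/bond percolation) are probability measures on `{0,1}^ι`.  This file brings them under the
Hilbert-cube results of `SahiBoxTP2HilbertPositivity.lean`: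

* `IsBoxTP2.map_of_galoisConnection` — box-TP₂ is transported along any measurable map with a left and a right adjoint
  (boxes pull back to boxes; only monotonicity of the measure is used for the mixed corners); `galoisConnection_piMap`.
* `boolToI : Bool → [0,1]` with its adjoints `boolCeil ⊣ boolToI ⊣ boolFloor`; the coordinatewise embedding
  `spinsToHilbert : {0,1}^ℕ → [0,1]^ℕ` and its monotone measurable left inverse `hilbertToSpins` (rounding); hence
  **a box-TP₂ law on `{0,1}^ℕ` embeds as a box-TP₂ law on the Hilbert cube** (`IsBoxTP2.map_spinsToHilbert`) and a
  monotone `f` on `{0,1}^ℕ` is the restriction of the monotone `f ∘ hilbertToSpins`: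
  `msahiE_nonneg_of_isBoxTP2_spins` (+ `_antitone`).
* `isBoxTP2_of_latticeCondition_singleton` — on a finite distributive lattice, the FKG lattice condition on POINT
  masses gives box-TP₂ (Mathlib's `four_functions_theorem` on boxes, `sum_filter_Icc_mul_le`); with the marginal
  criterion of `SahiBoxTP2HilbertMarginals.lean`: **a probability measure on `{0,1}^ℕ` all of whose finite-dimensional
  marginals satisfy the FKG lattice condition on cylinder probabilities is box-TP₂** (`isBoxTP2_of_fkg_marginals`).
* THEOREM `msahiE_nonneg_of_fkg_marginals` (+ `_of_sahiConjecture`, `_antitone`): **given `C_n`, every such law has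
  `E_n(f_0,…,f_{n−1}) ≥ 0` for all measurable nonnegative monotone `f_i` of the whole configuration**; UNCONDITIONALLY
  (`n = 2`) `integral_mul_integral_le_of_fkg_marginals`: the FKG inequality in infinite volume, `∫ f ∫ g ≤ ∫ f g`.

Countable index sets (`ℤ^d`): `SahiBoxTP2BooleanSpinsCountable.lean`.  HONEST FRAMING (cell rule): `SahiConjecture n`
(`n ≥ 3`) is OPEN and enters only as a hypothesis; the unconditional content is the order-`2` (FKG) layer, classical for
measures with the FKG lattice condition (Fortuin–Kasteleyn–Ginibre 1971; Holley 1974; infinite volume by martingale /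
cylinder approximation, Grimmett 1999 Thm 2.4) — here obtained for all bounded measurable monotone functions through the
box-TP₂ coupling.  No sorries, no new axioms.
-/

noncomputable section

namespace Summit.CriticalPhenomena.PercolationContinuityZ3.Theorems.SahiBoxTP2

open MeasureTheory ProbabilityTheory Set Filter Topology Function Literature.Combinatorics.Sahi2008
open scoped ENNReal unitInterval

/-! ### Box-TP₂ is transported along maps with both adjoints -/

section Galois

/-- **Box-TP₂ passes to the image under a measurable map with a left and a right adjoint** (`a ≤ φ x ↔ l a ≤ x`,
`φ x ≤ b ↔ x ≤ r b`): boxes pull back to boxes, `φ⁻¹[a,b] = [l a, r b]`, and `l (a ⊔ a') = l a ⊔ l a'`,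
`r (b ⊓ b') = r b ⊓ r b'`, `l (a ⊓ a') ≤ l a ⊓ l a'`, `r b ⊔ r b' ≤ r (b ⊔ b')`. [folklore] -/
theorem IsBoxTP2.map_of_galoisConnection {β γ : Type*} [Lattice β] [Lattice γ] [MeasurableSpace β]
    [MeasurableSpace γ] {μ : Measure β} (hμ : IsBoxTP2 μ) {φ : β → γ} (hφ : Measurable φ) {l r : γ → β}
    (hl : GaloisConnection l φ) (hr : GaloisConnection φ r) (hIcc : ∀ a b : γ, MeasurableSet (Icc a b)) :
    IsBoxTP2 (μ.map φ) := by
  have hpre : ∀ a b : γ, φ ⁻¹' Icc a b = Icc (l a) (r b) := fun a b => by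
    ext x
    simp only [mem_preimage, mem_Icc]
    rw [← hl a x, hr x b]
  intro a b a' b'
  simp only [Measure.map_apply hφ (hIcc _ _), hpre]
  calc μ (Icc (l a) (r b)) * μ (Icc (l a') (r b'))
      ≤ μ (Icc (l a ⊓ l a') (r b ⊓ r b')) * μ (Icc (l a ⊔ l a') (r b ⊔ r b')) := hμ _ _ _ _
    _ ≤ μ (Icc (l (a ⊓ a')) (r (b ⊓ b'))) * μ (Icc (l (a ⊔ a')) (r (b ⊔ b'))) := by
        refine mul_le_mul' (measure_mono (Icc_subset_Icc ?_ (hr.u_inf (b₁ := b) (b₂ := b')).symm.le))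
          (measure_mono (Icc_subset_Icc (hl.l_sup (a₁ := a) (a₂ := a')).le ?_))
        · exact le_inf (hl.monotone_l inf_le_left) (hl.monotone_l inf_le_right)
        · exact sup_le (hr.monotone_u le_sup_left) (hr.monotone_u le_sup_right)

/-- Galois connections act coordinatewise on function lattices. [folklore] -/
theorem galoisConnection_piMap {ι β γ : Type*} [Preorder β] [Preorder γ] {l : γ → β} {u : β → γ}
    (h : GaloisConnection l u) : GaloisConnection (fun (a : ι → γ) k => l (a k)) (fun (x : ι → β) k => u (x k)) :=
  fun a x => ⟨fun hle k => (h (a k) (x k)).1 (hle k), fun hle k => (h (a k) (x k)).2 (hle k)⟩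

/-- Extension by a constant along an injection `j : κ → ι` is left adjoint (constant `⊥`) to restriction `u ↦ u ∘ j`.
[folklore] -/
theorem galoisConnection_extend_bot {κ ι β : Type*} [Preorder β] [OrderBot β] {j : κ → ι} (hj : Injective j) :
    GaloisConnection (fun a : κ → β => Function.extend j a (fun _ => ⊥)) (fun u : ι → β => u ∘ j) := by
  classical
  intro a u
  change Function.extend j a (fun _ => ⊥) ≤ u ↔ a ≤ u ∘ j
  constructor
  · intro h k
    have := h (j k)
    rwa [hj.extend_apply] at this
  · intro h i
    by_cases hi : ∃ k, j k = i
    · obtain ⟨k, rfl⟩ := hi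
      rw [hj.extend_apply]; exact h k
    · rw [Function.extend_apply' _ _ _ hi]; exact bot_le

/-- Extension by a constant along an injection is right adjoint (constant `⊤`) to restriction. [folklore] -/
theorem galoisConnection_extend_top {κ ι β : Type*} [Preorder β] [OrderTop β] {j : κ → ι} (hj : Injective j) :
    GaloisConnection (fun u : ι → β => u ∘ j) (fun b : κ → β => Function.extend j b (fun _ => ⊤)) := by
  classical
  intro u b
  change u ∘ j ≤ b ↔ u ≤ Function.extend j b (fun _ => ⊤)
  constructor
  · intro h i
    by_cases hi : ∃ k, j k = i
    · obtain ⟨k, rfl⟩ := hi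
      rw [hj.extend_apply]; exact h k
    · rw [Function.extend_apply' _ _ _ hi]; exact le_top
  · intro h k
    have := h (j k)
    rwa [hj.extend_apply] at this

/-- **Box-TP₂ passes to the law of any sub-family of coordinates** (restriction along an injection `j : κ → ι`):
for the box condition — unlike for MTP₂ DENSITIES (Karlin–Rinott 1980, Prop. 3.2, an integration) — this is immediate,
a box pulling back to a box. [this work] -/
theorem IsBoxTP2.map_restrictComp {κ ι β : Type*} [Lattice β] [BoundedOrder β] [MeasurableSpace β]
    {μ : Measure (ι → β)} (hμ : IsBoxTP2 μ) {j : κ → ι} (hj : Injective j)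
    (hIcc : ∀ a b : κ → β, MeasurableSet (Icc a b)) : IsBoxTP2 (μ.map fun u : ι → β => u ∘ j) :=
  hμ.map_of_galoisConnection (measurable_pi_lambda _ fun k => measurable_pi_apply (j k))
    (galoisConnection_extend_bot hj) (galoisConnection_extend_top hj) hIcc

end Galois

/-! ### `{0,1}`-valued coordinates inside `[0,1]` -/

section Bool

open Classical in
/-- Left adjoint of the embedding `Bool → [0,1]`: `a ↦ (a ≠ 0)`. -/
def boolCeil (a : I) : Bool := decide (a ≠ 0)

open Classical in
/-- Right adjoint of the embedding `Bool → [0,1]`: `b ↦ (b = 1)`. -/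
def boolFloor (b : I) : Bool := decide (b = 1)

/-- The embedding `Bool → [0,1]`, `false ↦ 0`, `true ↦ 1`. -/
def boolToI (x : Bool) : I := if x then 1 else 0

/-- `a ≤ ι(x) ↔ ⌈a⌉ ≤ x`. [folklore] -/
theorem galoisConnection_boolCeil : GaloisConnection boolCeil boolToI := by
  intro a x
  cases x
  · simp only [boolToI, Bool.le_iff_imp, boolCeil, decide_eq_true_eq, ne_eq, Bool.false_eq_true, imp_false,
      not_not, if_false]
    exact ⟨fun h => h.symm ▸ le_rfl, fun h => le_antisymm h bot_le |> fun e => e⟩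
  · simp only [boolToI, if_true, Bool.le_true, true_iff]
    exact unitInterval.le_one a

/-- `ι(x) ≤ b ↔ x ≤ ⌊b⌋`. [folklore] -/
theorem galoisConnection_boolFloor : GaloisConnection boolToI boolFloor := by
  intro x b
  cases x
  · simp only [boolToI, Bool.false_le, iff_true]
    exact bot_le
  · simp only [boolToI, if_true, Bool.le_iff_imp, boolFloor, decide_eq_true_eq, forall_const]
    exact ⟨fun h => le_antisymm (unitInterval.le_one b) h, fun h => h ▸ le_rfl⟩

/-- `⌊ι(x)⌋ = x`. [folklore] -/
@[simp] theorem boolFloor_boolToI (x : Bool) : boolFloor (boolToI x) = x := by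
  cases x
  · simp only [boolToI, boolFloor, decide_eq_false_iff_not]
    exact zero_ne_one
  · simp only [boolToI, boolFloor, if_true, decide_eq_true_eq]

/-- `ι` is monotone. [folklore] -/
theorem boolToI_mono : Monotone boolToI := galoisConnection_boolFloor.monotone_l

/-- `⌊·⌋` is monotone. [folklore] -/
theorem boolFloor_mono : Monotone boolFloor := galoisConnection_boolFloor.monotone_u

/-- Every function out of `Bool` into `[0,1]` is measurable. [folklore] -/
theorem measurable_boolToI : Measurable boolToI := measurable_from_top

/-- `⌊·⌋ : [0,1] → Bool` is measurable. [folklore] -/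
theorem measurable_boolFloor : Measurable boolFloor := by
  refine measurable_to_countable' fun x => ?_
  have : boolFloor ⁻¹' {x} = if x then {1} else {1}ᶜ := by
    ext a
    cases x <;> simp [boolFloor]
  rw [this]
  split_ifs
  · exact measurableSet_singleton 1
  · exact (measurableSet_singleton 1).compl

end Bool

/-! ### Sequences of two-valued spins inside the Hilbert cube -/

section Spins

/-- The coordinatewise embedding `{0,1}^ℕ → [0,1]^ℕ`. -/
def spinsToHilbert (u : ℕ → Bool) : ℕ → I := fun k => boolToI (u k)

/-- The coordinatewise rounding `[0,1]^ℕ → {0,1}^ℕ`, `v ↦ (v_k = 1)_k`, a monotone left inverse. -/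
def hilbertToSpins (v : ℕ → I) : ℕ → Bool := fun k => boolFloor (v k)

/-- Rounding after embedding is the identity. [folklore] -/
@[simp] theorem hilbertToSpins_spinsToHilbert (u : ℕ → Bool) : hilbertToSpins (spinsToHilbert u) = u := by
  funext k; exact boolFloor_boolToI (u k)

/-- The embedding is measurable. [folklore] -/
theorem measurable_spinsToHilbert : Measurable spinsToHilbert :=
  measurable_pi_lambda _ fun k => measurable_boolToI.comp (measurable_pi_apply k)

/-- The rounding is measurable. [folklore] -/
theorem measurable_hilbertToSpins : Measurable hilbertToSpins :=
  measurable_pi_lambda _ fun k => measurable_boolFloor.comp (measurable_pi_apply k)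

/-- The embedding is monotone. [folklore] -/
theorem spinsToHilbert_mono : Monotone spinsToHilbert := fun _ _ h k => boolToI_mono (h k)

/-- The rounding is monotone. [folklore] -/
theorem hilbertToSpins_mono : Monotone hilbertToSpins := fun _ _ h k => boolFloor_mono (h k)

/-- **A box-TP₂ law on `{0,1}^ℕ` embeds as a box-TP₂ law on the Hilbert cube.** [this work] -/
theorem IsBoxTP2.map_spinsToHilbert {μ : Measure (ℕ → Bool)} (hμ : IsBoxTP2 μ) :
    IsBoxTP2 (μ.map spinsToHilbert) :=
  hμ.map_of_galoisConnection measurable_spinsToHilbert (galoisConnection_piMap galoisConnection_boolCeil)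
    (galoisConnection_piMap galoisConnection_boolFloor) fun _ _ => measurableSet_Icc

variable {n : ℕ}

/-- **`(∀ d, LiebSahiContinuum d n)` ⟹ every box-TP₂ probability measure on `{0,1}^ℕ` is Sahi-positive of order
`n`** for all measurable nonnegative monotone families (embed in the Hilbert cube; a monotone `f` on `{0,1}^ℕ` is the
restriction of the monotone `f ∘ round` on `[0,1]^ℕ`). [this work] -/
theorem msahiE_nonneg_of_isBoxTP2_spins (hL : ∀ d, LiebSahiContinuum d n) (μ : Measure (ℕ → Bool))
    [IsProbabilityMeasure μ] (hμ : IsBoxTP2 μ) (f : Fin n → (ℕ → Bool) → ℝ) (hfm : ∀ i, Measurable (f i))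
    (hf0 : ∀ i u, 0 ≤ f i u) (hmono : ∀ i, Monotone (f i)) : 0 ≤ msahiE μ n f := by
  haveI : IsProbabilityMeasure (μ.map spinsToHilbert) :=
    Measure.isProbabilityMeasure_map measurable_spinsToHilbert.aemeasurable
  have hmp : MeasurePreserving spinsToHilbert μ (μ.map spinsToHilbert) := ⟨measurable_spinsToHilbert, rfl⟩
  have key := msahiE_nonneg_of_isBoxTP2_hilbert hL (μ.map spinsToHilbert) hμ.map_spinsToHilbert
    (fun i => f i ∘ hilbertToSpins) (fun i => (hfm i).comp measurable_hilbertToSpins) (fun i v => hf0 i _)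
    fun i v w hvw => hmono i (hilbertToSpins_mono hvw)
  rw [← msahiE_comp_measurePreserving_of_measurable hmp n _ fun i => (hfm i).comp measurable_hilbertToSpins] at key
  have e : (fun i => (f i ∘ hilbertToSpins) ∘ spinsToHilbert) = f := by
    funext i u
    simp only [Function.comp_apply, hilbertToSpins_spinsToHilbert]
  rwa [e] at key

/-- Decreasing families on `{0,1}^ℕ`. [this work] -/
theorem msahiE_nonneg_of_isBoxTP2_spins_antitone (hL : ∀ d, LiebSahiContinuum d n) (μ : Measure (ℕ → Bool))
    [IsProbabilityMeasure μ] (hμ : IsBoxTP2 μ) (f : Fin n → (ℕ → Bool) → ℝ) (hfm : ∀ i, Measurable (f i))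
    (hf0 : ∀ i u, 0 ≤ f i u) (hanti : ∀ i, Antitone (f i)) : 0 ≤ msahiE μ n f := by
  haveI : IsProbabilityMeasure (μ.map spinsToHilbert) :=
    Measure.isProbabilityMeasure_map measurable_spinsToHilbert.aemeasurable
  have hmp : MeasurePreserving spinsToHilbert μ (μ.map spinsToHilbert) := ⟨measurable_spinsToHilbert, rfl⟩
  have key := msahiE_nonneg_of_isBoxTP2_hilbert_antitone hL (μ.map spinsToHilbert) hμ.map_spinsToHilbert
    (fun i => f i ∘ hilbertToSpins) (fun i => (hfm i).comp measurable_hilbertToSpins) (fun i v => hf0 i _)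
    fun i v w hvw => hanti i (hilbertToSpins_mono hvw)
  rw [← msahiE_comp_measurePreserving_of_measurable hmp n _ fun i => (hfm i).comp measurable_hilbertToSpins] at key
  have e : (fun i => (f i ∘ hilbertToSpins) ∘ spinsToHilbert) = f := by
    funext i u
    simp only [Function.comp_apply, hilbertToSpins_spinsToHilbert]
  rwa [e] at key

end Spins

/-! ### The FKG lattice condition on the finite-dimensional marginals -/

section Marginals

/-- **Four functions on boxes**: for a nonnegative weight on a finite distributive lattice satisfying the FKG lattice
condition, `w[p,q]·w[p',q'] ≤ w[p ⊓ p', q ⊓ q']·w[p ⊔ p', q ⊔ q']` (box masses). [folklore] -/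
theorem sum_filter_Icc_mul_le {α : Type*} [DistribLattice α] [Fintype α] [DecidableEq α] {w : α → ℝ}
    (hw0 : ∀ x, 0 ≤ w x) (hw : ∀ a b, w a * w b ≤ w (a ⊓ b) * w (a ⊔ b)) (p q p' q' : α)
    [DecidablePred (· ∈ Icc p q)] [DecidablePred (· ∈ Icc p' q')] [DecidablePred (· ∈ Icc (p ⊓ p') (q ⊓ q'))]
    [DecidablePred (· ∈ Icc (p ⊔ p') (q ⊔ q'))] :
    (∑ c ∈ Finset.univ.filter (· ∈ Icc p q), w c) * (∑ c ∈ Finset.univ.filter (· ∈ Icc p' q'), w c) ≤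
      (∑ c ∈ Finset.univ.filter (· ∈ Icc (p ⊓ p') (q ⊓ q')), w c) *
        (∑ c ∈ Finset.univ.filter (· ∈ Icc (p ⊔ p') (q ⊔ q')), w c) := by
  have h4 := four_functions_theorem w w w w hw0 hw0 hw0 hw0 hw (Finset.univ.filter (· ∈ Icc p q))
    (Finset.univ.filter (· ∈ Icc p' q'))
  refine h4.trans (mul_le_mul ?_ ?_ (Finset.sum_nonneg fun c _ => hw0 c) (Finset.sum_nonneg fun c _ => hw0 c))
  · refine Finset.sum_le_sum_of_subset_of_nonneg (fun c hc => ?_) fun c _ _ => hw0 c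
    obtain ⟨a, ha, b, hb, rfl⟩ := Finset.mem_infs.1 hc
    simp only [Finset.mem_filter, Finset.mem_univ, true_and, mem_Icc] at ha hb ⊢
    exact ⟨inf_le_inf ha.1 hb.1, inf_le_inf ha.2 hb.2⟩
  · refine Finset.sum_le_sum_of_subset_of_nonneg (fun c hc => ?_) fun c _ _ => hw0 c
    obtain ⟨a, ha, b, hb, rfl⟩ := Finset.mem_sups.1 hc
    simp only [Finset.mem_filter, Finset.mem_univ, true_and, mem_Icc] at ha hb ⊢
    exact ⟨sup_le_sup ha.1 hb.1, sup_le_sup ha.2 hb.2⟩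

/-- On a finite space with measurable points, the mass of a set is the sum of its point masses. [folklore] -/
theorem measureReal_eq_sum_filter {α : Type*} [Fintype α] [MeasurableSpace α] [MeasurableSingletonClass α]
    (ν : Measure α) [IsFiniteMeasure ν] (S : Set α) [DecidablePred (· ∈ S)] :
    ν.real S = ∑ c ∈ Finset.univ.filter (· ∈ S), ν.real {c} := by
  rw [← measureReal_biUnion_finset (fun c _ d _ hcd => disjoint_singleton.2 hcd)
    fun c _ => measurableSet_singleton c]
  congr 1
  ext x
  simp

/-- **A finite measure on a finite distributive lattice whose point weights satisfy the FKG lattice condition is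
box-TP₂.** [folklore] -/
theorem isBoxTP2_of_latticeCondition_singleton {α : Type*} [DistribLattice α] [Fintype α] [MeasurableSpace α]
    [MeasurableSingletonClass α] (ν : Measure α) [IsFiniteMeasure ν]
    (hν : ∀ a b : α, ν.real {a} * ν.real {b} ≤ ν.real {a ⊓ b} * ν.real {a ⊔ b}) : IsBoxTP2 ν := by
  classical
  intro p q p' q'
  have hreal : ∀ S : Set α, ν S = ENNReal.ofReal (ν.real S) := fun S => (ENNReal.ofReal_toReal (measure_ne_top ν S)).symm
  rw [hreal (Icc p q), hreal (Icc p' q'), hreal (Icc (p ⊓ p') (q ⊓ q')), hreal (Icc (p ⊔ p') (q ⊔ q')),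
    ← ENNReal.ofReal_mul measureReal_nonneg, ← ENNReal.ofReal_mul measureReal_nonneg]
  refine ENNReal.ofReal_le_ofReal ?_
  rw [measureReal_eq_sum_filter ν (Icc p q), measureReal_eq_sum_filter ν (Icc p' q'),
    measureReal_eq_sum_filter ν (Icc (p ⊓ p') (q ⊓ q')), measureReal_eq_sum_filter ν (Icc (p ⊔ p') (q ⊔ q'))]
  exact sum_filter_Icc_mul_le (fun x => measureReal_nonneg) hν p q p' q'

/-- **A probability measure on `{0,1}^ℕ` all of whose finite-dimensional marginals satisfy the FKG lattice condition
(on cylinder probabilities) is box-TP₂** — e.g. every weak limit of finite-volume FKG lattice measures (Ising, random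
cluster), since the condition is closed and passes to marginals. [this work] -/
theorem isBoxTP2_of_fkg_marginals (μ : Measure (ℕ → Bool)) [IsFiniteMeasure μ]
    (hfkg : ∀ (d : ℕ) (x y : Fin d → Bool),
      μ.real {u | finRestrict d u = x} * μ.real {u | finRestrict d u = y} ≤
        μ.real {u | finRestrict d u = x ⊓ y} * μ.real {u | finRestrict d u = x ⊔ y}) : IsBoxTP2 μ := by
  have hIcc : ∀ (d : ℕ) (a b : Fin d → Bool), MeasurableSet (Icc a b) := fun d a b => (Set.toFinite _).measurableSet
  refine (isBoxTP2_iff_forall_map_finRestrict hIcc).2 fun d => ?_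
  haveI : IsFiniteMeasure (μ.map (finRestrict d)) := Measure.isFiniteMeasure_map μ _
  refine isBoxTP2_of_latticeCondition_singleton _ fun a b => ?_
  have e : ∀ x : Fin d → Bool, (μ.map (finRestrict d)).real {x} = μ.real {u | finRestrict d u = x} := fun x => by
    rw [measureReal_def, Measure.map_apply (measurable_finRestrict d) (measurableSet_singleton x), ← measureReal_def]
    rfl
  simp only [e]
  exact hfkg d a b

variable {n : ℕ}

/-- **THEOREM (two-valued spins).** If `LiebSahiContinuum d n` holds for every `d` (⟺ `SahiConjecture n`), then every
probability measure on `{0,1}^ℕ` whose finite-dimensional marginals satisfy the FKG lattice condition satisfies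
`E_n(f_0,…,f_{n−1}) ≥ 0` for ALL measurable nonnegative monotone `f_i`. [this work] -/
theorem msahiE_nonneg_of_fkg_marginals (hL : ∀ d, LiebSahiContinuum d n) (μ : Measure (ℕ → Bool))
    [IsProbabilityMeasure μ]
    (hfkg : ∀ (d : ℕ) (x y : Fin d → Bool),
      μ.real {u | finRestrict d u = x} * μ.real {u | finRestrict d u = y} ≤
        μ.real {u | finRestrict d u = x ⊓ y} * μ.real {u | finRestrict d u = x ⊔ y})
    (f : Fin n → (ℕ → Bool) → ℝ) (hfm : ∀ i, Measurable (f i)) (hf0 : ∀ i u, 0 ≤ f i u)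
    (hmono : ∀ i, Monotone (f i)) : 0 ≤ msahiE μ n f :=
  msahiE_nonneg_of_isBoxTP2_spins hL μ (isBoxTP2_of_fkg_marginals μ hfkg) f hfm hf0 hmono

/-- The same from `C_n`. [this work; cite: Sahi2008, Conj. 5 (p. 212); LiebSahi2021, Conj. 1.1] -/
theorem msahiE_nonneg_of_fkg_marginals_of_sahiConjecture (hC : SahiConjecture n) (μ : Measure (ℕ → Bool))
    [IsProbabilityMeasure μ]
    (hfkg : ∀ (d : ℕ) (x y : Fin d → Bool),
      μ.real {u | finRestrict d u = x} * μ.real {u | finRestrict d u = y} ≤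
        μ.real {u | finRestrict d u = x ⊓ y} * μ.real {u | finRestrict d u = x ⊔ y})
    (f : Fin n → (ℕ → Bool) → ℝ) (hfm : ∀ i, Measurable (f i)) (hf0 : ∀ i u, 0 ≤ f i u)
    (hmono : ∀ i, Monotone (f i)) : 0 ≤ msahiE μ n f :=
  msahiE_nonneg_of_fkg_marginals ((sahiConjecture_iff_forall_liebSahiContinuum n).1 hC) μ hfkg f hfm hf0 hmono

/-- Decreasing families. [this work] -/
theorem msahiE_nonneg_of_fkg_marginals_antitone (hL : ∀ d, LiebSahiContinuum d n) (μ : Measure (ℕ → Bool))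
    [IsProbabilityMeasure μ]
    (hfkg : ∀ (d : ℕ) (x y : Fin d → Bool),
      μ.real {u | finRestrict d u = x} * μ.real {u | finRestrict d u = y} ≤
        μ.real {u | finRestrict d u = x ⊓ y} * μ.real {u | finRestrict d u = x ⊔ y})
    (f : Fin n → (ℕ → Bool) → ℝ) (hfm : ∀ i, Measurable (f i)) (hf0 : ∀ i u, 0 ≤ f i u)
    (hanti : ∀ i, Antitone (f i)) : 0 ≤ msahiE μ n f :=
  msahiE_nonneg_of_isBoxTP2_spins_antitone hL μ (isBoxTP2_of_fkg_marginals μ hfkg) f hfm hf0 hanti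

/-- **Unconditionally: the FKG inequality in infinite volume.** Every probability measure on `{0,1}^ℕ` with
FKG-lattice finite-dimensional marginals is positively associated: `∫ f ∫ g ≤ ∫ f g` for all measurable
nonnegative monotone `f, g` (depending on infinitely many coordinates). [this work] -/
theorem integral_mul_integral_le_of_fkg_marginals (μ : Measure (ℕ → Bool)) [IsProbabilityMeasure μ]
    (hfkg : ∀ (d : ℕ) (x y : Fin d → Bool),
      μ.real {u | finRestrict d u = x} * μ.real {u | finRestrict d u = y} ≤
        μ.real {u | finRestrict d u = x ⊓ y} * μ.real {u | finRestrict d u = x ⊔ y})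
    {f g : (ℕ → Bool) → ℝ} (hfm : Measurable f) (hgm : Measurable g) (hf0 : ∀ u, 0 ≤ f u) (hg0 : ∀ u, 0 ≤ g u)
    (hf : Monotone f) (hg : Monotone g) : (∫ u, f u ∂μ) * (∫ u, g u ∂μ) ≤ ∫ u, f u * g u ∂μ := by
  have h := msahiE_nonneg_of_fkg_marginals (fun d => liebSahiContinuum_of_order_le_two d le_rfl) μ hfkg ![f, g]
    (fun i => by fin_cases i <;> assumption) (fun i => by fin_cases i <;> assumption)
    (fun i => by fin_cases i <;> assumption)
  rw [msahiE_two] at h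
  linarith

end Marginals

end Summit.CriticalPhenomena.PercolationContinuityZ3.Theorems.SahiBoxTP2
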